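import Summits.NavierStokesRegularity.FunctionalMining.TopEigSaturatingSlope
import Summits.NavierStokesRegularity.FunctionalMining.TopEigBalanceTLD
import HarnessLib

/-!
# FunctionalMining — Theorem G (ii) of SIEVELD §3.4 in the kernel: Lemma L-λ ⇒ the `T_LD` rows of the `λ₁` / `−λ₃` cores

Search for candidate a priori estimates; no regularity claim. Cell `pub-nsfunc`, prove seat
(gen 17). The dictionary's `TopEigTLDOfCoercive q` (`TopEigHeatCoercive.lean`: "Theorem G (ii) …
as a NAMED implication (not kernel-checked) … claimed on paper, UNREVIEWED in Lean") is settled here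
for every real `q ≥ 2`, in the honest form that the NON-SMOOTH spectral moment
`Φ = ∫(λ₁⁺)^q(S)` admits (no derivative of `s ↦ Φ(u s)` is assumed to exist):

* `TopEig.sub_le_mul_of_heatCoercive_admissible` — FENCE FORM. For an admissible density `g`
  (convex, `1`-Lipschitz, `0 ≤ g(S) ≤ |S| ≤ 6 g(S)` on divergence-free strains) and `Φ = ∫ g(S)^q`:
  if `c·Φ ≤ heatDissipation Φ` on smooth zero-mean divergence-free fields (Lemma L-λ at rate
  `c > 0`, `HeatCoercive Φ c`), there is `κ ≥ 0` such that along every zero-mean classical solution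
  of unforced Navier–Stokes (`ν > 0`) on `T³ × [a, b]`, for `t₁ ≤ t₂` in the window and every `K`
  with `κ ν^{−γ} (2ℰ(u σ)) Φ(u σ)^{1+1/σ} ≤ K` on `[t₁, t₂]`: `Φ(u t₂) − Φ(u t₁) ≤ K (t₂ − t₁)`
  (`σ = 2q − 3`, `γ = (3q−3)/(2q−3)` — the K0 `T_LD` exponents);
* `TopEig.hasDerivWithinAt_le_of_heatCoercive_admissible` — DERIVATIVE-VALUE FORM: every one-sided
  derivative value `R` of `s ↦ Φ(u s)` within `[a, b]` obeys `R ≤ κ ν^{−γ} (2ℰ) Φ^{1+1/σ}`;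
* rows: `TopEig.topEigMoment_rate_le_of_heatCoercive` (`TopEigHeatCoercive q c`, `c > 0` ⇒ the
  `ES.lam1.q | T_LD` law in derivative-value form), `TopEig.negBotEigMoment_rate_le_of_heatCoercive`
  (`−λ₃` core); and `TopEig.topEigMomentSaturatingLaw_of_coercive_of_differentiable`: the typed
  `TopEigMomentSaturatingLaw q κ` (`SaturatingLaw` = `IsRateBudget`, which additionally DEMANDS
  differentiability of `s ↦ Φ(u s)`) follows from `TopEigHeatCoercivePos q` as soon as that
  differentiability is supplied — the only part of `TopEigTLDOfCoercive` not settled here, and not a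
  statement about the estimate (for the convex spectral weight the two one-sided derivatives exist but
  can differ where `λ₁ = λ₂ > 0` on a set of positive measure).

Proof: `TopEigBalanceTLD` (ε-level inequality with the viscous term kept and the convexity gain),
`TopEigSaturatingModuli` (ε-uniform form), `TopEigSaturatingSlope` (L-λ at the point, Dini fencing);
`β = c/(2+2c)` so that `2β ≤ (1−β)c`. Constants existential (Sobolev, strain and pressure-Hessian
Calderón–Zygmund, coercivity factor `6`, and `c`). [ours]
-/

noncomputable section

open MeasureTheory Set Filter Topology Finset
open scoped InnerProductSpace RealInnerProductSpace ContDiff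

namespace Summit.NavierStokesRegularity.FunctionalMining

open Literature.Analysis.FunctionSpaces Literature.Analysis.FluidPDE

namespace TopEig

open StrainL4 StrainMoment VorticityL4 StrainTensor

/-! ## 1. The fence form for an admissible density -/

/-- **Lemma L-λ ⇒ the `T_LD` law, fence form** (module docstring). [ours] -/
theorem sub_le_mul_of_heatCoercive_admissible {q : ℝ} (hq : 2 ≤ q)
    {g : EuclideanSpace ℝ (Fin 3 × Fin 3) → ℝ} (hconv : ConvexOn ℝ univ g) (hlip : LipschitzWith 1 g)
    (hg0 : ∀ v : UnitAddTorus (Fin 3) → EuclideanSpace ℝ (Fin 3), Torus.IsSmooth v →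
      Torus.IsDivFree v → ∀ x, 0 ≤ g (strainFlat v x))
    (hg6 : ∀ v : UnitAddTorus (Fin 3) → EuclideanSpace ℝ (Fin 3), Torus.IsSmooth v →
      Torus.IsDivFree v → ∀ x, ‖strainFlat v x‖ ≤ 6 * g (strainFlat v x))
    (hgle : ∀ v : UnitAddTorus (Fin 3) → EuclideanSpace ℝ (Fin 3), Torus.IsSmooth v →
      Torus.IsDivFree v → ∀ x, g (strainFlat v x) ≤ ‖strainFlat v x‖)
    {Φ : (UnitAddTorus (Fin 3) → EuclideanSpace ℝ (Fin 3)) → ℝ}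
    (hΦ : ∀ v : UnitAddTorus (Fin 3) → EuclideanSpace ℝ (Fin 3), Torus.IsSmooth v →
      Torus.IsDivFree v → Φ v = ∫ x, g (strainFlat v x) ^ q)
    {c : ℝ} (hc : 0 < c) (hL : HeatCoercive (d := Fin 3) Φ c) :
    ∃ κ : ℝ, 0 ≤ κ ∧ ∀ {ν a b : ℝ}, 0 < ν → a < b →
      ∀ {u : ℝ → UnitAddTorus (Fin 3) → EuclideanSpace ℝ (Fin 3)} {p : ℝ → UnitAddTorus (Fin 3) → ℝ},
      Torus.IsClassicalNSSolutionOn (Icc a b) ν 0 u p → (∀ t ∈ Icc a b, Torus.HasZeroMean (u t)) →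
      ∀ {t₁ t₂ : ℝ}, t₁ ∈ Icc a b → t₂ ∈ Icc a b → t₁ ≤ t₂ → ∀ {K : ℝ},
      (∀ σ ∈ Icc t₁ t₂, κ * ν ^ (-((3 * q - 3) / (2 * q - 3))) *
        ((2 * torusEnstrophy (u σ)) * Φ (u σ) ^ (1 + (2 * q - 3)⁻¹)) ≤ K) →
      Φ (u t₂) - Φ (u t₁) ≤ K * (t₂ - t₁) := by
  have hq1 : 1 < q := by linarith
  -- the static constants
  obtain ⟨CS, hCS, hSob⟩ := exists_integral_pow_six_le_inhom (d := Fin 3) (by simp)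
  obtain ⟨Kz, hKz0, hKz⟩ := exists_cz_rpow (q := q) (by linarith)
  obtain ⟨CP, hCP0, hCP⟩ := exists_hess_rpow (d := Fin 3) (q := q) hq1
  -- the parameter `β = c/(2+2c)`: `2β ≤ (1-β)c`, `0 < β ≤ 1`
  set β : ℝ := c / (2 + 2 * c) with hβ
  have h2c : 0 < 2 + 2 * c := by linarith
  have hβ0 : 0 < β := div_pos hc h2c
  have hβ1 : β ≤ 1 := by rw [hβ, div_le_one h2c]; linarith
  have hβc : 2 * β ≤ (1 - β) * c := by
    rw [hβ]
    have e1 : 2 * (c / (2 + 2 * c)) = 2 * c / (2 + 2 * c) := by ring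
    have e2 : (1 - c / (2 + 2 * c)) * c = (2 + c) * c / (2 + 2 * c) := by field_simp; ring
    rw [e1, e2, div_le_div_iff_of_pos_right h2c]
    nlinarith
  obtain ⟨Kc, hKc0, hKc⟩ := weight_hasDerivWithinAt_TLD' hq hCS hKz0 hCP0 hSob hKz hβ0
  refine ⟨Kc, hKc0, ?_⟩
  intro ν a b hν hab u p hsol hmean t₁ t₂ ht₁ ht₂ h12 K hK
  rcases eq_or_lt_of_le h12 with heq | hlt
  · rw [heq]; simp
  -- restrict the solution to `[t₁, t₂]`
  have hsub : Icc t₁ t₂ ⊆ Icc a b := Icc_subset_Icc ht₁.1 ht₂.2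
  have hsol' := hsol.mono hsub (uniqueDiffOn_Icc hlt)
  have hmean' : ∀ t ∈ Icc t₁ t₂, Torus.HasZeroMean (u t) := fun t ht => hmean t (hsub ht)
  have hCP' : ∀ t ∈ Icc t₁ t₂, ∀ i j : Fin 3,
      ∫ x, |Torus.partialDeriv i (Torus.partialDeriv j (p t)) x| ^ q ≤
        CP * ∫ x, (∑ k, ‖Torus.partialDeriv k (u t) x‖ ^ 2) ^ q :=
    fun t ht i j => hCP hab hsol t (hsub ht) i j
  have hunif := fun τ (hτ : 0 < τ) =>
    weight_deriv_le_uniform hq hβ0 hβ1 hKc0 hKc hlt hν hsol' hCP' hconv hlip hg0 hg6 hτ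
  have h := sub_le_mul_of_heatCoercive hq hν hlt hβ0 hβ1 hβc hKc0 hsol' hmean' hconv hlip hg0 hgle hΦ
    hL hunif hK (s := t₂) (right_mem_Icc.2 h12)
  linarith

/-! ## 2. The derivative-value form -/

/-- `s ↦ K₀ ν^{−γ} (2ℰ(u s)) Φ(u s)^{p}` is continuous within the window at every time, along a
classical solution (`Φ = ∫ g(S)^q`, `g` continuous, `≥ 0` on divergence-free strains, `p ≥ 0`).
[ours] -/
theorem continuousWithinAt_budget {q : ℝ} (hq : 0 ≤ q)
    {g : EuclideanSpace ℝ (Fin 3 × Fin 3) → ℝ} (hgc : Continuous g)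
    (hg0 : ∀ v : UnitAddTorus (Fin 3) → EuclideanSpace ℝ (Fin 3), Torus.IsSmooth v →
      Torus.IsDivFree v → ∀ x, 0 ≤ g (strainFlat v x))
    {Φ : (UnitAddTorus (Fin 3) → EuclideanSpace ℝ (Fin 3)) → ℝ}
    (hΦ : ∀ v : UnitAddTorus (Fin 3) → EuclideanSpace ℝ (Fin 3), Torus.IsSmooth v →
      Torus.IsDivFree v → Φ v = ∫ x, g (strainFlat v x) ^ q)
    {ν a b : ℝ} (hab : a < b)
    {u : ℝ → UnitAddTorus (Fin 3) → EuclideanSpace ℝ (Fin 3)} {p : ℝ → UnitAddTorus (Fin 3) → ℝ}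
    (hsol : Torus.IsClassicalNSSolutionOn (Icc a b) ν 0 u p) {K₀ e pw : ℝ} (hpw : 0 ≤ pw)
    {t : ℝ} (ht : t ∈ Icc a b) :
    ContinuousWithinAt (fun s => K₀ * ν ^ e * ((2 * torusEnstrophy (u s)) * Φ (u s) ^ pw))
      (Icc a b) t := by
  have hU : UniqueDiffOn ℝ (Icc a b) := uniqueDiffOn_Icc hab
  have hu : Torus.IsSmoothSpaceTimeOn (Icc a b) u := hsol.smooth_velocity
  have hE : ContinuousWithinAt (fun s => torusEnstrophy (u s)) (Icc a b) t :=
    (hsol.hasDerivWithinAt_half_gradNormSq hab ht).continuousWithinAt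
  have hF : ContinuousWithinAt (fun s => Φ (u s)) (Icc a b) t := by
    have h := (continuousOn_integral_comp_strain hU hu hgc hq).congr (fun s hs =>
      hΦ (u s) (hu.isSmooth_slice hs) (hsol.divFree s hs)) t ht
    exact h
  have hF0 : ∀ s ∈ Icc a b, 0 ≤ Φ (u s) := fun s hs => by
    rw [hΦ (u s) (hu.isSmooth_slice hs) (hsol.divFree s hs)]
    exact integral_nonneg fun y => Real.rpow_nonneg (hg0 _ (hu.isSmooth_slice hs) (hsol.divFree s hs) y) _
  have hFp : ContinuousWithinAt (fun s => Φ (u s) ^ pw) (Icc a b) t :=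
    hF.rpow_const (Or.inr hpw)
  have h2E : ContinuousWithinAt (fun s => 2 * torusEnstrophy (u s)) (Icc a b) t :=
    continuousWithinAt_const.mul hE
  exact continuousWithinAt_const.mul (h2E.mul hFp)

/-- **Lemma L-λ ⇒ the `T_LD` law, derivative-value form** (module docstring): every one-sided
derivative value of `s ↦ Φ(u s)` within the window is bounded by the `T_LD` budget. [ours] -/
theorem hasDerivWithinAt_le_of_heatCoercive_admissible {q : ℝ} (hq : 2 ≤ q)
    {g : EuclideanSpace ℝ (Fin 3 × Fin 3) → ℝ} (hconv : ConvexOn ℝ univ g) (hlip : LipschitzWith 1 g)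
    (hg0 : ∀ v : UnitAddTorus (Fin 3) → EuclideanSpace ℝ (Fin 3), Torus.IsSmooth v →
      Torus.IsDivFree v → ∀ x, 0 ≤ g (strainFlat v x))
    (hg6 : ∀ v : UnitAddTorus (Fin 3) → EuclideanSpace ℝ (Fin 3), Torus.IsSmooth v →
      Torus.IsDivFree v → ∀ x, ‖strainFlat v x‖ ≤ 6 * g (strainFlat v x))
    (hgle : ∀ v : UnitAddTorus (Fin 3) → EuclideanSpace ℝ (Fin 3), Torus.IsSmooth v →
      Torus.IsDivFree v → ∀ x, g (strainFlat v x) ≤ ‖strainFlat v x‖)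
    {Φ : (UnitAddTorus (Fin 3) → EuclideanSpace ℝ (Fin 3)) → ℝ}
    (hΦ : ∀ v : UnitAddTorus (Fin 3) → EuclideanSpace ℝ (Fin 3), Torus.IsSmooth v →
      Torus.IsDivFree v → Φ v = ∫ x, g (strainFlat v x) ^ q)
    {c : ℝ} (hc : 0 < c) (hL : HeatCoercive (d := Fin 3) Φ c) :
    ∃ κ : ℝ, 0 ≤ κ ∧ ∀ {ν a b : ℝ}, 0 < ν → a < b →
      ∀ {u : ℝ → UnitAddTorus (Fin 3) → EuclideanSpace ℝ (Fin 3)} {p : ℝ → UnitAddTorus (Fin 3) → ℝ},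
      Torus.IsClassicalNSSolutionOn (Icc a b) ν 0 u p → (∀ t ∈ Icc a b, Torus.HasZeroMean (u t)) →
      ∀ t ∈ Icc a b, ∀ R : ℝ, HasDerivWithinAt (fun s => Φ (u s)) R (Icc a b) t →
        R ≤ κ * ν ^ (-((3 * q - 3) / (2 * q - 3))) *
          ((2 * torusEnstrophy (u t)) * Φ (u t) ^ (1 + (2 * q - 3)⁻¹)) := by
  obtain ⟨κ, hκ0, hκ⟩ := sub_le_mul_of_heatCoercive_admissible hq hconv hlip hg0 hg6 hgle hΦ hc hL
  refine ⟨κ, hκ0, ?_⟩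
  intro ν a b hν hab u p hsol hmean t ht R hR
  have hq0 : 0 ≤ q := by linarith
  have hpw : 0 ≤ 1 + (2 * q - 3)⁻¹ := by
    have : 0 < 2 * q - 3 := by linarith
    have := inv_pos.2 this; linarith
  set bud : ℝ → ℝ := fun s => κ * ν ^ (-((3 * q - 3) / (2 * q - 3))) *
    ((2 * torusEnstrophy (u s)) * Φ (u s) ^ (1 + (2 * q - 3)⁻¹)) with hbud
  have hcont : ContinuousWithinAt bud (Icc a b) t :=
    continuousWithinAt_budget hq0 hlip.continuous hg0 hΦ hab hsol hpw ht
  show R ≤ bud t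
  refine le_of_forall_gt_imp_ge_of_dense fun r hr => ?_
  -- a neighbourhood of `t` in the window on which `bud < r'`, `r' = (bud t + r)/2`
  set r' : ℝ := (bud t + r) / 2 with hr'
  have hr't : bud t < r' := by rw [hr']; linarith
  have hr'r : r' < r := by rw [hr']; linarith
  obtain ⟨δ, hδ, hδP⟩ := Metric.continuousWithinAt_iff.1 hcont (r' - bud t) (by linarith)
  have hnear : ∀ σ ∈ Icc a b, dist σ t < δ → bud σ ≤ r' := by
    intro σ hσ hd
    have h := hδP hσ hd
    rw [Real.dist_eq, abs_lt] at h
    linarith [h.2]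
  set f : ℝ → ℝ := fun s => Φ (u s) with hf
  rcases lt_or_eq_of_le ht.2 with htb | htb
  · -- right slopes on `(t, t + δ) ∩ (t, b)`
    set z₀ : ℝ := min (t + δ) b with hz₀
    have htz₀ : t < z₀ := lt_min (by linarith) htb
    have hsub : Ioo t z₀ ⊆ Icc a b := fun z hz =>
      ⟨ht.1.trans hz.1.le, (le_of_lt hz.2).trans (min_le_right _ _)⟩
    have hR' : HasDerivWithinAt f R (Ioo t z₀) t := hR.mono hsub
    have htend := (hasDerivWithinAt_iff_tendsto_slope' (by simp : t ∉ Ioo t z₀)).mp hR'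
    haveI : (𝓝[Ioo t z₀] t).NeBot := left_nhdsWithin_Ioo_neBot htz₀
    have hev : ∀ᶠ z in 𝓝[Ioo t z₀] t, slope f t z ≤ r' := by
      filter_upwards [self_mem_nhdsWithin] with z hz
      have hzab : z ∈ Icc a b := hsub hz
      have hKz : ∀ σ ∈ Icc t z, bud σ ≤ r' := by
        intro σ hσ
        refine hnear σ ⟨ht.1.trans hσ.1, hσ.2.trans hzab.2⟩ ?_
        rw [Real.dist_eq, abs_of_nonneg (by linarith [hσ.1])]
        have : z < t + δ := lt_of_lt_of_le hz.2 (min_le_left _ _)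
        linarith [hσ.2]
      have h := hκ hν hab hsol hmean ht hzab hz.1.le hKz
      rw [slope_def_field, div_le_iff₀ (by linarith [hz.1])]
      simpa [hf] using h
    exact (le_of_tendsto htend hev).trans hr'r.le
  · -- `t = b`: left slopes on `(max (t - δ) a, t)`
    have hat : a < t := by rw [htb]; exact hab
    set z₀ : ℝ := max (t - δ) a with hz₀
    have hz₀t : z₀ < t := max_lt (by linarith) hat
    have hsub : Ioo z₀ t ⊆ Icc a b := fun z hz =>
      ⟨(le_max_right _ _).trans hz.1.le, hz.2.le.trans ht.2⟩
    have hR' : HasDerivWithinAt f R (Ioo z₀ t) t := hR.mono hsub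
    have htend := (hasDerivWithinAt_iff_tendsto_slope' (by simp : t ∉ Ioo z₀ t)).mp hR'
    haveI : (𝓝[Ioo z₀ t] t).NeBot := right_nhdsWithin_Ioo_neBot hz₀t
    have hev : ∀ᶠ z in 𝓝[Ioo z₀ t] t, slope f t z ≤ r' := by
      filter_upwards [self_mem_nhdsWithin] with z hz
      have hzab : z ∈ Icc a b := hsub hz
      have hKz : ∀ σ ∈ Icc z t, bud σ ≤ r' := by
        intro σ hσ
        refine hnear σ ⟨hzab.1.trans hσ.1, hσ.2.trans ht.2⟩ ?_
        rw [Real.dist_eq, abs_of_nonpos (by linarith [hσ.2])]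
        have : t - δ < z := lt_of_le_of_lt (le_max_left _ _) hz.1
        linarith [hσ.1]
      have h := hκ hν hab hsol hmean hzab ht hz.2.le hKz
      have e : slope f t z = (f t - f z) / (t - z) := by
        rw [slope_def_field, ← neg_sub (f t) (f z), ← neg_sub t z, neg_div_neg_eq]
      rw [e, div_le_iff₀ (by linarith [hz.2])]
      simpa [hf] using h
    exact (le_of_tendsto htend hev).trans hr'r.le

/-! ## 3. The rows: the `λ₁` and `−λ₃` cores -/

/-- **Row `ES.lam1.q | T_LD` given Lemma L-λ(q), derivative-value form** (every real `q ≥ 2`): if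
`TopEigHeatCoercive q c` holds with `c > 0` then there is `κ ≥ 0` such that along every zero-mean
classical solution of unforced Navier–Stokes on `T³` (`ν > 0`), every one-sided derivative value `R`
of `s ↦ ∫(λ₁⁺)^q(S(u s))` within the window satisfies
`R ≤ κ ν^{−(3q−3)/(2q−3)} (2ℰ) (∫(λ₁⁺)^q)^{1+1/(2q−3)}`. [ours; Theorem G (ii) in the kernel] -/
theorem topEigMoment_rate_le_of_heatCoercive {q : ℝ} (hq : 2 ≤ q) {c : ℝ} (hc : 0 < c)
    (hL : TopEigHeatCoercive (d := Fin 3) q c) :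
    ∃ κ : ℝ, 0 ≤ κ ∧ ∀ {ν a b : ℝ}, 0 < ν → a < b →
      ∀ {u : ℝ → UnitAddTorus (Fin 3) → EuclideanSpace ℝ (Fin 3)} {p : ℝ → UnitAddTorus (Fin 3) → ℝ},
      Torus.IsClassicalNSSolutionOn (Icc a b) ν 0 u p → (∀ t ∈ Icc a b, Torus.HasZeroMean (u t)) →
      ∀ t ∈ Icc a b, ∀ R : ℝ, HasDerivWithinAt (fun s => torusTopEigMoment q (u s)) R (Icc a b) t →
        R ≤ κ * ν ^ (-((3 * q - 3) / (2 * q - 3))) *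
          ((2 * torusEnstrophy (u t)) * torusTopEigMoment q (u t) ^ (1 + (2 * q - 3)⁻¹)) :=
  hasDerivWithinAt_le_of_heatCoercive_admissible hq convexOn_lam lipschitzWith_lam
    (fun _ hv hdiv x => lam_strainFlat_nonneg hv hdiv x)
    (fun _ hv hdiv x => norm_strainFlat_le hv hdiv x)
    (fun _ _ _ _ => lam_le_norm _)
    (fun _ hv hdiv => torusTopEigMoment_eq hv hdiv q) hc hL

/-- **Row `ES.lam1.q | T_LD` given Lemma L-λ(q), fence form**: with the same `κ`, for `t₁ ≤ t₂` in
the window and any `K` dominating the budget on `[t₁, t₂]`,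
`∫(λ₁⁺)^q(S(u t₂)) − ∫(λ₁⁺)^q(S(u t₁)) ≤ K (t₂ − t₁)`. [ours] -/
theorem topEigMoment_sub_le_of_heatCoercive {q : ℝ} (hq : 2 ≤ q) {c : ℝ} (hc : 0 < c)
    (hL : TopEigHeatCoercive (d := Fin 3) q c) :
    ∃ κ : ℝ, 0 ≤ κ ∧ ∀ {ν a b : ℝ}, 0 < ν → a < b →
      ∀ {u : ℝ → UnitAddTorus (Fin 3) → EuclideanSpace ℝ (Fin 3)} {p : ℝ → UnitAddTorus (Fin 3) → ℝ},
      Torus.IsClassicalNSSolutionOn (Icc a b) ν 0 u p → (∀ t ∈ Icc a b, Torus.HasZeroMean (u t)) →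
      ∀ {t₁ t₂ : ℝ}, t₁ ∈ Icc a b → t₂ ∈ Icc a b → t₁ ≤ t₂ → ∀ {K : ℝ},
      (∀ σ ∈ Icc t₁ t₂, κ * ν ^ (-((3 * q - 3) / (2 * q - 3))) *
        ((2 * torusEnstrophy (u σ)) * torusTopEigMoment q (u σ) ^ (1 + (2 * q - 3)⁻¹)) ≤ K) →
      torusTopEigMoment q (u t₂) - torusTopEigMoment q (u t₁) ≤ K * (t₂ - t₁) :=
  sub_le_mul_of_heatCoercive_admissible hq convexOn_lam lipschitzWith_lam
    (fun _ hv hdiv x => lam_strainFlat_nonneg hv hdiv x)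
    (fun _ hv hdiv x => norm_strainFlat_le hv hdiv x)
    (fun _ _ _ _ => lam_le_norm _)
    (fun _ hv hdiv => torusTopEigMoment_eq hv hdiv q) hc hL

/-- **Row `ES.neglam3.q | T_LD` given Lemma L-λ(q) for the `−λ₃` core, derivative-value form**
(every real `q ≥ 2`). [ours] -/
theorem negBotEigMoment_rate_le_of_heatCoercive {q : ℝ} (hq : 2 ≤ q) {c : ℝ} (hc : 0 < c)
    (hL : NegBotEigHeatCoercive (d := Fin 3) q c) :
    ∃ κ : ℝ, 0 ≤ κ ∧ ∀ {ν a b : ℝ}, 0 < ν → a < b →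
      ∀ {u : ℝ → UnitAddTorus (Fin 3) → EuclideanSpace ℝ (Fin 3)} {p : ℝ → UnitAddTorus (Fin 3) → ℝ},
      Torus.IsClassicalNSSolutionOn (Icc a b) ν 0 u p → (∀ t ∈ Icc a b, Torus.HasZeroMean (u t)) →
      ∀ t ∈ Icc a b, ∀ R : ℝ, HasDerivWithinAt (fun s => torusNegBotEigMoment q (u s)) R (Icc a b) t →
        R ≤ κ * ν ^ (-((3 * q - 3) / (2 * q - 3))) *
          ((2 * torusEnstrophy (u t)) * torusNegBotEigMoment q (u t) ^ (1 + (2 * q - 3)⁻¹)) :=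
  hasDerivWithinAt_le_of_heatCoercive_admissible (g := fun A => lam (-A)) hq convexOn_lam_neg
    lipschitzWith_lam_neg
    (fun _ hv hdiv x => lam_neg_strainFlat_nonneg hv hdiv x)
    (fun _ hv hdiv x => norm_strainFlat_le_lam_neg hv hdiv x)
    (fun v _ _ x => (lam_le_norm _).trans (norm_neg (strainFlat v x)).le)
    (fun _ hv hdiv => torusNegBotEigMoment_eq hv hdiv q) hc hL

/-- **Row `ES.neglam3.q | T_LD` given Lemma L-λ(q) for the `−λ₃` core, fence form.** [ours] -/
theorem negBotEigMoment_sub_le_of_heatCoercive {q : ℝ} (hq : 2 ≤ q) {c : ℝ} (hc : 0 < c)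
    (hL : NegBotEigHeatCoercive (d := Fin 3) q c) :
    ∃ κ : ℝ, 0 ≤ κ ∧ ∀ {ν a b : ℝ}, 0 < ν → a < b →
      ∀ {u : ℝ → UnitAddTorus (Fin 3) → EuclideanSpace ℝ (Fin 3)} {p : ℝ → UnitAddTorus (Fin 3) → ℝ},
      Torus.IsClassicalNSSolutionOn (Icc a b) ν 0 u p → (∀ t ∈ Icc a b, Torus.HasZeroMean (u t)) →
      ∀ {t₁ t₂ : ℝ}, t₁ ∈ Icc a b → t₂ ∈ Icc a b → t₁ ≤ t₂ → ∀ {K : ℝ},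
      (∀ σ ∈ Icc t₁ t₂, κ * ν ^ (-((3 * q - 3) / (2 * q - 3))) *
        ((2 * torusEnstrophy (u σ)) * torusNegBotEigMoment q (u σ) ^ (1 + (2 * q - 3)⁻¹)) ≤ K) →
      torusNegBotEigMoment q (u t₂) - torusNegBotEigMoment q (u t₁) ≤ K * (t₂ - t₁) :=
  sub_le_mul_of_heatCoercive_admissible (g := fun A => lam (-A)) hq convexOn_lam_neg
    lipschitzWith_lam_neg
    (fun _ hv hdiv x => lam_neg_strainFlat_nonneg hv hdiv x)
    (fun _ hv hdiv x => norm_strainFlat_le_lam_neg hv hdiv x)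
    (fun v _ _ x => (lam_le_norm _).trans (norm_neg (strainFlat v x)).le)
    (fun _ hv hdiv => torusNegBotEigMoment_eq hv hdiv q) hc hL

/-! ## 4. The typed implication `TopEigTLDOfCoercive`, modulo differentiability -/

/-- **`TopEigTLDOfCoercive q` modulo the differentiability clause of `IsRateBudget`.** For real
`q ≥ 2`: `TopEigHeatCoercivePos q` (Lemma L-λ(q)) together with the differentiability of
`s ↦ ∫(λ₁⁺)^q(S(u s))` within the window at every time of every zero-mean classical solution (the
clause `SaturatingLaw`/`IsRateBudget` demands and which the kernel argument does not need) gives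
`∃ κ, TopEigMomentSaturatingLaw q κ`. [ours] -/
theorem topEigMomentSaturatingLaw_of_coercive_of_differentiable {q : ℝ} (hq : 2 ≤ q)
    (hL : TopEigHeatCoercivePos (d := Fin 3) q)
    (hdiff : ∀ {ν a b : ℝ}, 0 < ν → a < b →
      ∀ {u : ℝ → UnitAddTorus (Fin 3) → EuclideanSpace ℝ (Fin 3)} {p : ℝ → UnitAddTorus (Fin 3) → ℝ},
      Torus.IsClassicalNSSolutionOn (Icc a b) ν 0 u p → (∀ t ∈ Icc a b, Torus.HasZeroMean (u t)) →
      ∀ t ∈ Icc a b, DifferentiableWithinAt ℝ (fun s => torusTopEigMoment q (u s)) (Icc a b) t) :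
    ∃ κ : ℝ, TopEigMomentSaturatingLaw (d := Fin 3) q κ := by
  obtain ⟨c, hc, hLc⟩ := hL
  obtain ⟨κ, _, hκ⟩ := topEigMoment_rate_le_of_heatCoercive hq hc hLc
  refine ⟨κ, ?_⟩
  intro _ ν hν a b hab u p hsol hmean t ht
  have hd := hdiff hν hab hsol hmean t ht
  refine ⟨hd, ?_⟩
  have h := hκ hν hab hsol hmean t ht _ hd.hasDerivWithinAt
  calc derivWithin (fun s => torusTopEigMoment q (u s)) (Icc a b) t
      ≤ κ * ν ^ (-((3 * q - 3) / (2 * q - 3))) *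
          ((2 * torusEnstrophy (u t)) * torusTopEigMoment q (u t) ^ (1 + (2 * q - 3)⁻¹)) := h
    _ = κ * ν ^ (-((3 * q - 3) / (2 * q - 3))) * (2 * torusEnstrophy (u t)) *
          torusTopEigMoment q (u t) ^ (1 + (2 * q - 3)⁻¹) := by ring

/-- **Rows `ES.lam1.q | T_LD`, `q = 2, 3, 4`, conditional on L-λ(q)** (derivative-value form;
K0 exponents `(σ, γ) = (1, 3), (3, 2), (5, 9/5)`). [ours] -/
theorem topEigMoment_rate_le_of_heatCoercive_rows :
    (∀ c : ℝ, 0 < c → TopEigHeatCoercive (d := Fin 3) 2 c →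
      ∃ κ : ℝ, 0 ≤ κ ∧ ∀ {ν a b : ℝ}, 0 < ν → a < b →
        ∀ {u : ℝ → UnitAddTorus (Fin 3) → EuclideanSpace ℝ (Fin 3)} {p : ℝ → UnitAddTorus (Fin 3) → ℝ},
        Torus.IsClassicalNSSolutionOn (Icc a b) ν 0 u p → (∀ t ∈ Icc a b, Torus.HasZeroMean (u t)) →
        ∀ t ∈ Icc a b, ∀ R : ℝ,
          HasDerivWithinAt (fun s => torusTopEigMoment 2 (u s)) R (Icc a b) t →
          R ≤ κ * ν ^ (-(3 : ℝ)) * ((2 * torusEnstrophy (u t)) * torusTopEigMoment 2 (u t) ^ (2 : ℝ))) ∧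
    (∀ c : ℝ, 0 < c → TopEigHeatCoercive (d := Fin 3) 3 c →
      ∃ κ : ℝ, 0 ≤ κ ∧ ∀ {ν a b : ℝ}, 0 < ν → a < b →
        ∀ {u : ℝ → UnitAddTorus (Fin 3) → EuclideanSpace ℝ (Fin 3)} {p : ℝ → UnitAddTorus (Fin 3) → ℝ},
        Torus.IsClassicalNSSolutionOn (Icc a b) ν 0 u p → (∀ t ∈ Icc a b, Torus.HasZeroMean (u t)) →
        ∀ t ∈ Icc a b, ∀ R : ℝ,
          HasDerivWithinAt (fun s => torusTopEigMoment 3 (u s)) R (Icc a b) t →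
          R ≤ κ * ν ^ (-(2 : ℝ)) *
            ((2 * torusEnstrophy (u t)) * torusTopEigMoment 3 (u t) ^ (4 / 3 : ℝ))) ∧
    (∀ c : ℝ, 0 < c → TopEigHeatCoercive (d := Fin 3) 4 c →
      ∃ κ : ℝ, 0 ≤ κ ∧ ∀ {ν a b : ℝ}, 0 < ν → a < b →
        ∀ {u : ℝ → UnitAddTorus (Fin 3) → EuclideanSpace ℝ (Fin 3)} {p : ℝ → UnitAddTorus (Fin 3) → ℝ},
        Torus.IsClassicalNSSolutionOn (Icc a b) ν 0 u p → (∀ t ∈ Icc a b, Torus.HasZeroMean (u t)) →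
        ∀ t ∈ Icc a b, ∀ R : ℝ,
          HasDerivWithinAt (fun s => torusTopEigMoment 4 (u s)) R (Icc a b) t →
          R ≤ κ * ν ^ (-(9 / 5 : ℝ)) *
            ((2 * torusEnstrophy (u t)) * torusTopEigMoment 4 (u t) ^ (6 / 5 : ℝ))) := by
  refine ⟨fun c hc hL => ?_, fun c hc hL => ?_, fun c hc hL => ?_⟩
  · obtain ⟨κ, hκ0, hκ⟩ := topEigMoment_rate_le_of_heatCoercive (q := 2) (by norm_num) hc hL
    refine ⟨κ, hκ0, fun hν hab u p hsol hmean t ht R hR => ?_⟩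
    have h := hκ hν hab hsol hmean t ht R hR
    norm_num at h ⊢
    exact h
  · obtain ⟨κ, hκ0, hκ⟩ := topEigMoment_rate_le_of_heatCoercive (q := 3) (by norm_num) hc hL
    refine ⟨κ, hκ0, fun hν hab u p hsol hmean t ht R hR => ?_⟩
    have h := hκ hν hab hsol hmean t ht R hR
    norm_num at h ⊢
    exact h
  · obtain ⟨κ, hκ0, hκ⟩ := topEigMoment_rate_le_of_heatCoercive (q := 4) (by norm_num) hc hL
    refine ⟨κ, hκ0, fun hν hab u p hsol hmean t ht R hR => ?_⟩
    have h := hκ hν hab hsol hmean t ht R hR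
    norm_num at h ⊢
    exact h

end TopEig

end Summit.NavierStokesRegularity.FunctionalMining

end
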